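import Summits.BirchSwinnertonDyer.BirchSwinnertonDyer.Theses.CyclotomicUntwist
import Summits.BirchSwinnertonDyer.BirchSwinnertonDyer.Theses.SemiOrdinaryEisensteinDescent
import Summits.BirchSwinnertonDyer.BirchSwinnertonDyer.Theorems.CyclotomicUntwistPSTwistStability
import Summits.BirchSwinnertonDyer.BirchSwinnertonDyer.Theorems.WildThreeRankOneBSDpOfExactIndexManin
import Summits.BirchSwinnertonDyer.BirchSwinnertonDyer.Theorems.SchneiderFreeAdditiveX3UpperReceptacle
import Summits.BirchSwinnertonDyer.BirchSwinnertonDyer.Theorems.ClassRecordThreeStepLOfHalvesB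
import Summits.BirchSwinnertonDyer.Rank1Residual.GaloisImage.JWitnessTowerSurjectivity
import Literature.NumberTheory.EllipticCurves.BSDHeegnerPointsGrossZagierProofs
import Literature.NumberTheory.EllipticCurves.KrizLi2019.SexticTwistBSDThreeDescent
import Literature.NumberTheory.EllipticCurves.GlobalMinimalModelProofs
import Literature.NumberTheory.EllipticCurves.ModularCurveManinConstantProofs
import HarnessLib

/-!
# Route `CyclotomicUntwist` in its own row currency, ONTO binders: K1 / K2 from SOED's one-sided cruxes and the
# opposite half on the rank-ZERO principal-series rows WITH `ρ̄_{E,3}` ONTO — the rank-zero companions of K1/K2 in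
# the leaf's exact binder list (cross-route kernels; the twist transports `ρ̄₃` onto and the `3`-adic tower)

Cell `bsd-wall` (W-ALL, row 2 @3), prover seat `bsd-line-cycu-p3` (g0), 2026-08-27. HONEST FRAMING: CONDITIONAL
kernels — every crux / half named below is an ANTECEDENT; closes nothing; BSD₃ for no curve; 0 definitions, 0
named facts, 0 `sorry`.

The companion file `CyclotomicUntwistPSHalvesOfPSRankZeroHalves` stated the rank-zero PS halves with the image binder
«`E[3]` irreducible». This file is independent of it (imports only the two route files and route-free modules). The tree also transports SURJECTIVITY at every level `3^n` along a quadratic twist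
(`GaloisImage.hasSurjectiveModNGaloisRep_pow_iff_of_model_twist`, Silverman X.5.4: `E^{(d)}[m] ≅ E[m] ⊗ χ_d`, `−1`
a square in `Aut E[3^n]`), so the minimal Heegner twist of an onto PS row is an ONTO PS row with the SAME `3`-adic
tower behaviour (`psOntoRow_twist_of_heegner`). Hence the rank-zero inputs can be asked for in the leaf's exact
binders — `¬ HasCM → ClassO6 W 3 → Surj W 3 → v₃(Δ_min) even → Δ_min/3^v ≡ 1 (3) → r_an = 0 → (half)` — i.e. as
the RANK-ZERO COMPANIONS «K1₀» (lower half) / «K2₀» (upper half) of CU's K1 / K2: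

* §1 row-local kernels with the twist's half displayed AT THE DATUM (any supply):
  `upperHalf_towerRow_of_kolyvaginCrux_of_twistLowerHalf`, `lowerHalf_row_of_eisenstein_of_waldspurger_of_control_of_twistUpperHalf`;
* §2 `psOntoRow_twist_of_heegner` — the minimal Heegner twist of an onto PS row: non-CM, `ClassO6`, `ρ̄₃` ONTO, PS,
  `r_an = 0`, and `TowerSurjThree Wd ↔ TowerSurjThree W`;
* §3 **`psRankOneUpperHalfAtThree_of_kolyvaginCrux_of_psRankZeroLowerHalfOnto_of_psNonTowerUpperHalf`** — K2 ⟸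
  published inputs ∧ SOED Ko ∧ «K1₀: LOWER half on the onto rank-zero PS rows» ∧ «UPPER half on the non-tower rank-one
  PS rows»; and since Ko needs the tower only at `E` while the twist keeps the tower, the rank-zero input is needed
  on the TOWER-surjective rank-zero PS rows only (`…_towerOnly` form);
* §4 **`psRankOneLowerHalfAtThree_of_eisenstein_of_waldspurger_of_control_of_psRankZeroUpperHalfOnto`** — K1 ⟸
  published inputs ∧ SOED E ∧ V ∧ C ∧ «K2₀: UPPER half on the onto rank-zero PS rows».

PLANNER-LEVEL READING (bookkeeping, not a ruling): with rank-zero companions K1₀/K2₀ filed on the PS rows (the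
finite-slope road reads `L(E,1)` and `L′(E,1)` alike), the CU route's dependence on the wild rank-zero leaf
`WAllExclAddWildRankZero` disappears: K1 ⟸ {E, V, C, K2₀}, K2 ⟸ {Ko, K1₀ (tower rows), NT-upper}. BSD is not proved by
any of this.

References: [SilvermanAEC2009] X.5 Cor. 5.4; [GrossZagier1986] Thm. I.(6.3), (7.3), V.§2; [JetchevSkinnerWan2017] §7.4.1
(arXiv:1512.06894 p. 30); [Castella2018] Thm. 2.3, §5; [FriedbergHoffstein1995] Thm. B; [Jetchev2008] Thm. 1.4;
[Miller2011LMS] Def. 1.1; [Zywina2015] Prop. 1.14/1.16.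
-/

noncomputable section

open scoped Classical

set_option linter.dupNamespace false
set_option autoImplicit false

namespace Summit.BirchSwinnertonDyer.BirchSwinnertonDyer.Theorems.CyclotomicUntwistOfSOED

open WeierstrassCurve NumberField IsDedekindDomain Field
  Literature.NumberTheory.EllipticCurves
  Literature.NumberTheory.EllipticCurves.ModularForms
  Literature.NumberTheory.EllipticCurves.Rank1Residual
  Literature.NumberTheory.EllipticCurves.Rank1Residual.Typed
  Literature.NumberTheory.EllipticCurves.KrizLi2019
  Summit.BirchSwinnertonDyer.Rank1Residual
  Summit.BirchSwinnertonDyer.Rank1Residual.Additive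
  Summit.BirchSwinnertonDyer.Rank1Residual.X11b
  Summit.BirchSwinnertonDyer.Rank1Residual.X11b.AcSelmer
  Summit.BirchSwinnertonDyer.Rank1Residual.X11b.Halves
  Summit.BirchSwinnertonDyer.BirchSwinnertonDyer.Theses.SemiOrdinaryEisensteinDescent
  Summit.BirchSwinnertonDyer.BirchSwinnertonDyer.Theorems.CyclotomicUntwistPS

/-! ### §1 Row-local kernels with the twist's half displayed at the datum -/

/-- **UPPER half at ONE tower-surjective onto wild rank-one row ⟸ published inputs ∧ SOED Ko ∧ the LOWER half of every
minimal Heegner twist of THAT row** (imaginary quadratic `K`, Heegner for `N(E)`, `d_K` odd, `L(E^{(d_K)},1) ≠ 0`; any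
supply). Parity, Friedberg–Hoffstein mod `2`, Heegner point, Gross–Zagier, Ko = co-STEP L at slack `v₃(c)`,
`Upper.jointUpperBoundAt_of_coStepL_manin`, `Upper.missingUpperBoundAt_of_jointUpper_of_lower`. CONDITIONAL.
[cite: GrossZagier1986, Thm. I.(6.3) and (7.3)] [cite: FriedbergHoffstein1995, Thm. B]
[cite: JetchevSkinnerWan2017, §7.4.1 (arXiv:1512.06894 p. 30)] [cite: Jetchev2008, Thm. 1.4] -/
theorem upperHalf_towerRow_of_kolyvaginCrux_of_twistLowerHalf (hF : PublishedInputsWildThree)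
    (hKoly : WildKolyvaginUpperAtThree) (W : WeierstrassCurve ℚ) [W.IsElliptic] [W.IsGloballyMinimal]
    (hO6 : ClassO6 W 3) (hsurj : W.HasSurjectiveModNGaloisRep 3) (htower : AdditiveThree.TowerSurjThree W)
    (hr : W.analyticRank = 1)
    (hTwLo : ∀ (K : Type) [Field K] [NumberField K] (Wd : WeierstrassCurve ℚ) [Wd.IsElliptic] [Wd.IsGloballyMinimal]
      (Cd : VariableChange ℚ), IsImaginaryQuadratic K → Odd (NumberField.discr K) →
      SatisfiesHeegnerHypothesis (W.conductorNorm ℤ) K →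
      (W.quadraticTwist (NumberField.discr K : ℚ)).entireLFunction 1 ≠ 0 →
      Cd • W.quadraticTwist (NumberField.discr K : ℚ) = Wd → MissingLowerBoundAt Wd 3) :
    MissingUpperBoundAt W 3 := by
  obtain ⟨hGZ, hKo, hGZK, hmod, -, -, hGZ73, hFH, hpar, hHP⟩ := hF
  haveI hN0 : NeZero (W.conductorNorm ℤ) := ⟨W.conductorNorm_pos_holds.ne'⟩
  have hw : W.rootNumber = -1 := by
    rcases W.rootNumber_eq_one_or with h | h
    · exfalso
      have heven : Even W.analyticRank := (hpar W).mpr h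
      rw [hr] at heven
      exact Nat.not_even_one heven
    · exact h
  obtain ⟨K, _, _, hK, -, hHN, hH2, hLt⟩ := hFH W hw 2 two_ne_zero 0
  have hodd : Odd (NumberField.discr K) := by
    have h8 := Literature.SatisfiesHeegnerHypothesis.discr_emod_eight hK.1 hH2 (dvd_refl 2)
    rw [Int.odd_iff]; omega
  have h3N : 3 ∣ W.conductorNorm ℤ :=
    (W.dvd_conductorNorm_iff_not_hasGoodReductionAtPrime 3).mpr (not_good_of_addv W 3 hO6.2.1)
  have hd3 : NumberField.discr K ≠ -3 := by
    intro h
    exact Literature.SatisfiesHeegnerHypothesis.not_dvd_discr hK.1 hHN Nat.prime_three h3N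
      (by rw [h]; norm_num)
  have hwK : ¬ 3 ∣ Units.torsionOrder K :=
    (X11b.Three.not_dvd_discr_and_not_dvd_torsionOrder_of_heegner hK hHN (by decide) h3N).2
  obtain ⟨P, Dt, H, ι, hP⟩ := hHP W K hK hHN
  have hLone : W.entireLFunction 1 = 0 := entireLFunction_one_eq_zero_of_analyticRank_eq_one hr
  obtain ⟨-, hderiv⟩ := leadingLCoeff_eq_deriv_of_analyticRank_eq_one hr
  have hLK : LDerivEK W K ≠ 0 := by
    rw [lDerivEK_eq_deriv_mul W K hmod hLone]; exact mul_ne_zero hderiv hLt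
  have hnt : ¬ IsOfFinAddOrder P :=
    (lDerivEK_ne_zero_iff_not_isOfFinAddOrder W (W.conductorNorm ℤ) K (hGZ _ W K) hK hHN
      ⟨Dt, H, ι, hP⟩).mp hLK
  have hupI : SchneiderFree.Upper.IndexUpperBoundLeAt W 3 K P (padicValNat 3 Dt.c.natAbs) :=
    hKoly W (W.conductorNorm ℤ) K Dt H ι P hO6 hsurj hr rfl hK hHN hLt hP hnt hodd hd3 htower
  have hD0 : (NumberField.discr K : ℚ) ≠ 0 := by exact_mod_cast NumberField.discr_ne_zero K
  haveI : (W.quadraticTwist (NumberField.discr K : ℚ)).IsElliptic := W.isElliptic_quadraticTwist hD0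
  obtain ⟨Cd, hCd⟩ := hasGlobalMinimalModel_rat_holds (W.quadraticTwist (NumberField.discr K : ℚ))
  haveI : (Cd • W.quadraticTwist (NumberField.discr K : ℚ)).IsGloballyMinimal := hCd
  have hdlo : MissingLowerBoundAt (Cd • W.quadraticTwist (NumberField.discr K : ℚ)) 3 :=
    hTwLo K _ Cd hK hodd hHN hLt rfl
  exact SchneiderFree.Upper.missingUpperBoundAt_of_jointUpper_of_lower
    (SchneiderFree.Upper.jointUpperBoundAt_of_coStepL_manin hGZ hKo hGZK hmod hGZ73 W 3
      (W.conductorNorm ℤ) K Dt H ι P (Cd • W.quadraticTwist (NumberField.discr K : ℚ)) hr rfl h3N hK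
      hodd hwK hHN hLt hP ⟨Cd, rfl⟩ (by decide) hupI) hdlo

/-- **LOWER half at ONE onto wild rank-one row ⟸ published inputs ∧ SOED E ∧ V ∧ C ∧ the UPPER half of every minimal
Heegner twist of THAT row** (any supply). Steps (a)–(b) of the SOED kernel verbatim, `Exact.jointLowerBoundAt_of_stepL_manin`,
`Typed.missingLowerBoundAt_of_joint_of_upper`. CONDITIONAL; no tower binder.
[cite: JetchevSkinnerWan2017, §7.4.1 (arXiv:1512.06894 p. 30)] [cite: Castella2018, Thm. 2.3 and §5 (5.1)–(5.3)]
[cite: GrossZagier1986, Thm. I.(6.3) and V.§2] [cite: FriedbergHoffstein1995, Thm. B] -/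
theorem lowerHalf_row_of_eisenstein_of_waldspurger_of_control_of_twistUpperHalf (hF : PublishedInputsWildThree)
    (hE : WildSplitEisensteinInclusionAtThree) (hV : WildSplitWaldspurgerAtThree) (hC : WildSplitControlAtThree)
    (W : WeierstrassCurve ℚ) [W.IsElliptic] [W.IsGloballyMinimal]
    (hO6 : ClassO6 W 3) (hsurj : W.HasSurjectiveModNGaloisRep 3) (hr : W.analyticRank = 1)
    (hTwUp : ∀ (K : Type) [Field K] [NumberField K] (Wd : WeierstrassCurve ℚ) [Wd.IsElliptic] [Wd.IsGloballyMinimal]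
      (Cd : VariableChange ℚ), IsImaginaryQuadratic K → Odd (NumberField.discr K) →
      SatisfiesHeegnerHypothesis (W.conductorNorm ℤ) K →
      (W.quadraticTwist (NumberField.discr K : ℚ)).entireLFunction 1 ≠ 0 →
      Cd • W.quadraticTwist (NumberField.discr K : ℚ) = Wd → MissingUpperBoundAt Wd 3) :
    MissingLowerBoundAt W 3 := by
  obtain ⟨hGZ, hKo, hGZK, hmod, -, -, hGZ73, hFH, hpar, hHP⟩ := hF
  haveI hN0 : NeZero (W.conductorNorm ℤ) := ⟨W.conductorNorm_pos_holds.ne'⟩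
  have hw : W.rootNumber = -1 := by
    rcases W.rootNumber_eq_one_or with h | h
    · exfalso
      have heven : Even W.analyticRank := (hpar W).mpr h
      rw [hr] at heven
      exact Nat.not_even_one heven
    · exact h
  obtain ⟨K, _, _, hK, -, hHN, hH2, hLt⟩ := hFH W hw 2 two_ne_zero 0
  have hodd : Odd (NumberField.discr K) := by
    have h8 := Literature.SatisfiesHeegnerHypothesis.discr_emod_eight hK.1 hH2 (dvd_refl 2)
    rw [Int.odd_iff]; omega
  have h3N : 3 ∣ W.conductorNorm ℤ :=
    (W.dvd_conductorNorm_iff_not_hasGoodReductionAtPrime 3).mpr (not_good_of_addv W 3 hO6.2.1)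
  have hsplit : SplitsIn K 3 := hHN 3 Nat.prime_three h3N
  have hwK : ¬ 3 ∣ Units.torsionOrder K :=
    (X11b.Three.not_dvd_discr_and_not_dvd_torsionOrder_of_heegner hK hHN (by decide) h3N).2
  obtain ⟨P, Dt, H, ι, hP⟩ := hHP W K hK hHN
  have hLone : W.entireLFunction 1 = 0 := entireLFunction_one_eq_zero_of_analyticRank_eq_one hr
  obtain ⟨-, hderiv⟩ := leadingLCoeff_eq_deriv_of_analyticRank_eq_one hr
  have hLK : LDerivEK W K ≠ 0 := by
    rw [lDerivEK_eq_deriv_mul W K hmod hLone]; exact mul_ne_zero hderiv hLt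
  have hnt : ¬ IsOfFinAddOrder P :=
    (lDerivEK_ne_zero_iff_not_isOfFinAddOrder W (W.conductorNorm ℤ) K (hGZ _ W K) hK hHN
      ⟨Dt, H, ι, hP⟩).mp hLK
  obtain ⟨hrk, hfin⟩ := hKo (W.conductorNorm ℤ) W K hK hHN ⟨Dt, H, ι, hP⟩ hnt
  obtain ⟨κ, γ, -, hκ, hγ, -⟩ := X11b.exists_anticyclotomic_generator_prime (p := 3) hK
  haveI : Fact (κ.IsTopGenerator γ) := ⟨hγ⟩
  obtain ⟨𝔭, h𝔭, he, hf⟩ := X11b.exists_degreeOnePrime_of_splitsIn K 3 hK.1 hsplit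
  obtain ⟨𝔭', hne, h𝔭', he', hf'⟩ := X11b.Three.exists_ne_degreeOne_prime hK.1 h𝔭 he hf
  obtain ⟨ι', hind, ΩK, Ωp, L, hΩK, hΩp, hBDP, u, hval⟩ :=
    hV W (W.conductorNorm ℤ) K Dt H ι P hO6 hsurj hr rfl hK hHN hLt hP hnt κ hκ γ 𝔭 h𝔭 he hf
  have hctl : SchneiderFree.AdditiveControlOnTreeAt 3 κ 𝔭' γ (embAt K 3 𝔭' h𝔭' he' hf') P :=
    hC W (W.conductorNorm ℤ) K Dt H ι P hO6 hsurj hr rfl hK hHN hLt hP hnt (hKo _ W K) κ hκ γ 𝔭'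
      h𝔭' he' hf'
  obtain ⟨n, hn, hneq⟩ := hctl
  have hincl : (XAc.charIdeal (W.baseChange K) 3 κ 𝔭' ∅ γ).map (PowerSeries.map (toUnr 3)) ≤
      Ideal.span {L} :=
    hE W (W.conductorNorm ℤ) K Dt hO6 hsurj hr rfl hK hHN κ hκ γ 𝔭 h𝔭 he hf 𝔭' h𝔭' hne ι' hind
      ΩK Ωp L hΩK hΩp hBDP hn.1
  have hval' : L.HasValueAt 0 ((((u : unrIntegers 3) : unrIntegers 3) : ℂ_[3]) *
      (algebraMap ℚ_[3] ℂ_[3]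
        (logOmega W 3 (embAt K 3 𝔭' h𝔭' he' hf') P / (Dt.c : ℚ_[3]))) ^ 2) :=
    (SchneiderFreeAdditiveX3.hasValueAt_sq_logOmega_embAt_iff_of_rank_one W 3 hK.1 hrk h𝔭 he hf
      h𝔭' he' hf' P _ _ L).mpr hval
  have hc0 : Dt.c ≠ 0 := Dt.maninConstant_ne_zero_holds
  have hlog : logOmega W 3 (embAt K 3 𝔭' h𝔭' he' hf') P ≠ 0 := X11b.R1.logOmega_ne_zero W 3 _ hnt
  have hlow : SchneiderFree.AdditiveIMCLowerBDPOnTreeLeAt 3 κ 𝔭' γ (embAt K 3 𝔭' h𝔭' he' hf')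
      (padicValNat 3 Dt.c.natAbs) P := by
    obtain ⟨htors, f, hfI, hf0, hfn⟩ := hn
    have hmem : PowerSeries.map (toUnr 3) f ∈ Ideal.span {L} := by
      have h3 := hincl
      rw [hfI, CongruenceLimit.map_span_singleton_powerSeries] at h3
      exact (Ideal.span_singleton_le_iff_mem _).mp h3
    obtain ⟨-, hle⟩ := Supersingular.two_mul_valuation_le_of_mem_span 3 hf0 hmem u hval'
    have hc0' : (Dt.c : ℚ_[3]) ≠ 0 := by exact_mod_cast hc0
    rw [div_eq_mul_inv, Padic.valuation_mul hlog (inv_ne_zero hc0'), Padic.valuation_inv,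
      Padic.valuation_intCast, valuation_logOmega hlog, hfn] at hle
    refine ⟨n, ⟨htors, f, hfI, hf0, hfn⟩, ?_⟩
    simp only [padicValInt] at hle
    linarith
  have hlo : SchneiderFree.IndexLowerBoundLeAt W 3 K P (padicValNat 3 Dt.c.natAbs) :=
    SchneiderFreeAdditiveX3.indexLowerBoundLeAt_of_imcLowerLe_of_control rfl hK hHN hfin hlow
      ⟨n, hn, hneq⟩
  have hD0 : (NumberField.discr K : ℚ) ≠ 0 := by exact_mod_cast NumberField.discr_ne_zero K
  haveI : (W.quadraticTwist (NumberField.discr K : ℚ)).IsElliptic := W.isElliptic_quadraticTwist hD0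
  obtain ⟨Cd, hCd⟩ := hasGlobalMinimalModel_rat_holds (W.quadraticTwist (NumberField.discr K : ℚ))
  haveI : (Cd • W.quadraticTwist (NumberField.discr K : ℚ)).IsGloballyMinimal := hCd
  have hdup : MissingUpperBoundAt (Cd • W.quadraticTwist (NumberField.discr K : ℚ)) 3 :=
    hTwUp K _ Cd hK hodd hHN hLt rfl
  exact missingLowerBoundAt_of_joint_of_upper
    (SchneiderFree.Exact.jointLowerBoundAt_of_stepL_manin hGZ hKo hGZK hmod hGZ73 W 3 (W.conductorNorm ℤ)
      K Dt H ι P (Cd • W.quadraticTwist (NumberField.discr K : ℚ)) hr rfl h3N hK hodd hwK hHN hLt hP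
      ⟨Cd, rfl⟩ (by decide) hlo) hdup

/-! ### §2 The minimal Heegner twist of an onto PS row is an onto PS row with the same tower -/

/-- **Row data of the minimal Heegner twist of an ONTO PS row**: non-CM, `ClassO6 Wd 3`, `ρ̄_{Wd,3}` ONTO, PS, `r_an = 0`,
and `TowerSurjThree Wd ↔ TowerSurjThree W` (`GaloisImage.hasSurjectiveModNGaloisRep_pow_iff_of_model_twist` at every
level `3^n`; `classO6_twist_of_heegner`, `hasCM_iff_of_j_eq`, `CyclotomicUntwistPS.ps_iff_of_heegner_twist`). [cite: SilvermanAEC2009, X.5 Cor. 5.4]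
[cite: Zywina2015, Prop. 1.14 and Prop. 1.16] -/
theorem psOntoRow_twist_of_heegner (W : WeierstrassCurve ℚ) [W.IsElliptic] [W.IsGloballyMinimal]
    (hO6 : ClassO6 W 3) (hsurj : W.HasSurjectiveModNGaloisRep 3)
    (hev : Even (padicValInt 3 W.minimalDiscriminantInt))
    (hsq : W.minimalDiscriminantInt / 3 ^ padicValInt 3 W.minimalDiscriminantInt % 3 = 1)
    (K : Type) [Field K] [NumberField K] (hK : IsImaginaryQuadratic K) (hodd : Odd (NumberField.discr K))
    (hHN : SatisfiesHeegnerHypothesis (W.conductorNorm ℤ) K)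
    (hLd : (W.quadraticTwist (NumberField.discr K : ℚ)).entireLFunction 1 ≠ 0)
    (Wd : WeierstrassCurve ℚ) [Wd.IsElliptic] [Wd.IsGloballyMinimal] (Cd : VariableChange ℚ)
    (hCd : Cd • W.quadraticTwist (NumberField.discr K : ℚ) = Wd) :
    ¬ Wd.HasCM ∧ ClassO6 Wd 3 ∧ Wd.HasSurjectiveModNGaloisRep 3 ∧
      Even (padicValInt 3 Wd.minimalDiscriminantInt) ∧
      Wd.minimalDiscriminantInt / 3 ^ padicValInt 3 Wd.minimalDiscriminantInt % 3 = 1 ∧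
      Wd.analyticRank = 0 ∧ (AdditiveThree.TowerSurjThree Wd ↔ AdditiveThree.TowerSurjThree W) := by
  obtain ⟨hO6d, hjd⟩ := classO6_twist_of_heegner W hO6 K hK hHN hodd Wd Cd hCd
  have hCM : ¬ W.HasCM := fun hCM ↦
    W.not_hasSurjectiveModNGaloisRep_of_hasCM hCM Nat.prime_three (by decide) hsurj
  have hCMd : ¬ Wd.HasCM := fun h ↦ hCM ((hasCM_iff_of_j_eq hjd).mp h)
  have hD0 : (NumberField.discr K : ℚ) ≠ 0 := by exact_mod_cast NumberField.discr_ne_zero K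
  haveI : (W.quadraticTwist (NumberField.discr K : ℚ)).IsElliptic := W.isElliptic_quadraticTwist hD0
  have h3N : 3 ∣ W.conductorNorm ℤ :=
    (W.dvd_conductorNorm_iff_not_hasGoodReductionAtPrime 3).mpr (not_good_of_addv W 3 hO6.2.1)
  obtain ⟨hevd, hsqd⟩ := (ps_iff_of_heegner_twist W h3N K hK hHN Wd hCd).mpr ⟨hev, hsq⟩
  have hLd1 : Wd.entireLFunction 1 ≠ 0 := by rw [← hCd, entireLFunction_smul]; exact hLd
  have hrd : Wd.analyticRank = 0 := analyticRank_eq_zero_of_entireLFunction_one_ne_zero Wd hLd1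
  have hlev : ∀ n : ℕ, Wd.HasSurjectiveModNGaloisRep (3 ^ n : ℕ) ↔ W.HasSurjectiveModNGaloisRep (3 ^ n : ℕ) :=
    fun n ↦ GaloisImage.hasSurjectiveModNGaloisRep_pow_iff_of_model_twist W 3 hD0 ⟨Cd, hCd⟩ n
  have hsurjd : Wd.HasSurjectiveModNGaloisRep 3 := by
    have h := (hlev 1).mpr (by simpa using hsurj)
    simpa using h
  refine ⟨hCMd, hO6d, hsurjd, hevd, hsqd, hrd, ?_⟩
  unfold AdditiveThree.TowerSurjThree
  exact ⟨fun h n hn ↦ (hlev n).mp (h n hn), fun h n hn ↦ (hlev n).mpr (h n hn)⟩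

/-! ### §3 K2 from Ko, the rank-zero companion K1₀ (onto binders) and the non-tower upper half -/

/-- **UPPER half on the tower-surjective rank-one PS rows ⟸ published inputs ∧ SOED Ko ∧ «K1₀ on the TOWER rows»: the
LOWER half on the rank-ZERO PS rows with `ρ̄₃` onto and `3`-adic tower surjective** (the twist of a tower row is a tower
row). CONDITIONAL. [cite: JetchevSkinnerWan2017, §7.4.1 (arXiv:1512.06894 p. 30)] [cite: SilvermanAEC2009, X.5 Cor. 5.4] -/
theorem upperHalf_psTowerRows_of_kolyvaginCrux_of_psRankZeroLowerHalfOnto_towerOnly (hF : PublishedInputsWildThree)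
    (hKoly : WildKolyvaginUpperAtThree)
    (hL0 : ∀ (Wd : WeierstrassCurve ℚ) [Wd.IsElliptic] [Wd.IsGloballyMinimal],
      ¬ Wd.HasCM → ClassO6 Wd 3 → Surj Wd 3 → AdditiveThree.TowerSurjThree Wd →
      Even (padicValInt 3 Wd.minimalDiscriminantInt) →
      Wd.minimalDiscriminantInt / 3 ^ padicValInt 3 Wd.minimalDiscriminantInt % 3 = 1 →
      Wd.analyticRank = 0 → MissingLowerBoundAt Wd 3)
    (W : WeierstrassCurve ℚ) [W.IsElliptic] [W.IsGloballyMinimal]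
    (hO6 : ClassO6 W 3) (hsurj : W.HasSurjectiveModNGaloisRep 3) (htower : AdditiveThree.TowerSurjThree W)
    (hev : Even (padicValInt 3 W.minimalDiscriminantInt))
    (hsq : W.minimalDiscriminantInt / 3 ^ padicValInt 3 W.minimalDiscriminantInt % 3 = 1)
    (hr : W.analyticRank = 1) : MissingUpperBoundAt W 3 := by
  refine upperHalf_towerRow_of_kolyvaginCrux_of_twistLowerHalf hF hKoly W hO6 hsurj htower hr ?_
  intro K _ _ Wd _ _ Cd hK hodd hHN hLt hCd
  obtain ⟨hCMd, hO6d, hsurjd, hevd, hsqd, hrd, htw⟩ :=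
    psOntoRow_twist_of_heegner W hO6 hsurj hev hsq K hK hodd hHN hLt Wd Cd hCd
  exact hL0 Wd hCMd hO6d hsurjd (htw.mpr htower) hevd hsqd hrd

/-- **K2 `PSRankOneUpperHalfAtThree` (stmt-BirchSwinnertonDyer-21581) ⟸ published inputs ∧ SOED Ko ∧ K1₀ «LOWER half on
the onto rank-zero PS rows» (the leaf's binders with `r_an = 0`) ∧ «UPPER half on the non-tower rank-one PS rows».**
CONDITIONAL cross-route kernel; closes nothing; BSD is not proved by this. [cite: JetchevSkinnerWan2017, §7.4.1 (arXiv:1512.06894 p. 30)]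
[cite: Jetchev2008, Thm. 1.4] [cite: SilvermanAEC2009, X.5 Cor. 5.4] -/
theorem psRankOneUpperHalfAtThree_of_kolyvaginCrux_of_psRankZeroLowerHalfOnto_of_psNonTowerUpperHalf
    (hF : PublishedInputsWildThree) (hKoly : WildKolyvaginUpperAtThree)
    (hL0 : ∀ (Wd : WeierstrassCurve ℚ) [Wd.IsElliptic] [Wd.IsGloballyMinimal],
      ¬ Wd.HasCM → ClassO6 Wd 3 → Surj Wd 3 →
      Even (padicValInt 3 Wd.minimalDiscriminantInt) →
      Wd.minimalDiscriminantInt / 3 ^ padicValInt 3 Wd.minimalDiscriminantInt % 3 = 1 →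
      Wd.analyticRank = 0 → MissingLowerBoundAt Wd 3)
    (hNTu : ∀ (W : WeierstrassCurve ℚ) [W.IsElliptic] [W.IsGloballyMinimal],
      ¬ W.HasCM → ClassO6 W 3 → Surj W 3 → ¬ AdditiveThree.TowerSurjThree W →
      Even (padicValInt 3 W.minimalDiscriminantInt) →
      W.minimalDiscriminantInt / 3 ^ padicValInt 3 W.minimalDiscriminantInt % 3 = 1 →
      W.analyticRank = 1 → MissingUpperBoundAt W 3) :
    Summit.BirchSwinnertonDyer.BirchSwinnertonDyer.Theses.CyclotomicUntwist.PSRankOneUpperHalfAtThree := by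
  intro W _ _ hncm hO6 hsurj hev hsq hr
  by_cases htower : AdditiveThree.TowerSurjThree W
  · exact upperHalf_psTowerRows_of_kolyvaginCrux_of_psRankZeroLowerHalfOnto_towerOnly hF hKoly
      (fun Wd _ _ hCMd hO6d hsd _ hevd hsqd hrd ↦ hL0 Wd hCMd hO6d hsd hevd hsqd hrd) W hO6 hsurj htower hev hsq hr
  · exact hNTu W hncm hO6 hsurj htower hev hsq hr

/-! ### §4 K1 from E, V, C and the rank-zero companion K2₀ (onto binders) -/

/-- **LOWER half on every rank-one PS row ⟸ published inputs ∧ SOED E ∧ V ∧ C ∧ K2₀ «UPPER half on the onto rank-zero PS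
rows».** CONDITIONAL; no tower split, no wild-leaf import. [cite: JetchevSkinnerWan2017, §7.4.1 (arXiv:1512.06894 p. 30)]
[cite: Castella2018, Thm. 2.3 and §5] [cite: SilvermanAEC2009, X.5 Cor. 5.4] -/
theorem lowerHalf_psRows_of_eisenstein_of_waldspurger_of_control_of_psRankZeroUpperHalfOnto
    (hF : PublishedInputsWildThree) (hE : WildSplitEisensteinInclusionAtThree) (hV : WildSplitWaldspurgerAtThree)
    (hC : WildSplitControlAtThree)
    (hU0 : ∀ (Wd : WeierstrassCurve ℚ) [Wd.IsElliptic] [Wd.IsGloballyMinimal],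
      ¬ Wd.HasCM → ClassO6 Wd 3 → Surj Wd 3 →
      Even (padicValInt 3 Wd.minimalDiscriminantInt) →
      Wd.minimalDiscriminantInt / 3 ^ padicValInt 3 Wd.minimalDiscriminantInt % 3 = 1 →
      Wd.analyticRank = 0 → MissingUpperBoundAt Wd 3)
    (W : WeierstrassCurve ℚ) [W.IsElliptic] [W.IsGloballyMinimal]
    (hO6 : ClassO6 W 3) (hsurj : W.HasSurjectiveModNGaloisRep 3)
    (hev : Even (padicValInt 3 W.minimalDiscriminantInt))
    (hsq : W.minimalDiscriminantInt / 3 ^ padicValInt 3 W.minimalDiscriminantInt % 3 = 1)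
    (hr : W.analyticRank = 1) : MissingLowerBoundAt W 3 := by
  refine lowerHalf_row_of_eisenstein_of_waldspurger_of_control_of_twistUpperHalf hF hE hV hC W hO6 hsurj hr ?_
  intro K _ _ Wd _ _ Cd hK hodd hHN hLt hCd
  obtain ⟨hCMd, hO6d, hsurjd, hevd, hsqd, hrd, -⟩ :=
    psOntoRow_twist_of_heegner W hO6 hsurj hev hsq K hK hodd hHN hLt Wd Cd hCd
  exact hU0 Wd hCMd hO6d hsurjd hevd hsqd hrd

/-- **K1 `PSRankOneLowerHalfAtThree` (stmt-BirchSwinnertonDyer-21580) ⟸ published inputs ∧ SOED E ∧ V ∧ C ∧ K2₀ «UPPER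
half on the onto rank-zero PS rows» (the leaf's binders with `r_an = 0`).** CONDITIONAL cross-route kernel; closes
nothing; BSD is not proved by this. [cite: JetchevSkinnerWan2017, §7.4.1 (arXiv:1512.06894 p. 30)] [cite: Castella2018, Thm. 2.3 and §5]
[cite: GrossZagier1986, Thm. I.(6.3) and V.§2] -/
theorem psRankOneLowerHalfAtThree_of_eisenstein_of_waldspurger_of_control_of_psRankZeroUpperHalfOnto
    (hF : PublishedInputsWildThree) (hE : WildSplitEisensteinInclusionAtThree) (hV : WildSplitWaldspurgerAtThree)
    (hC : WildSplitControlAtThree)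
    (hU0 : ∀ (Wd : WeierstrassCurve ℚ) [Wd.IsElliptic] [Wd.IsGloballyMinimal],
      ¬ Wd.HasCM → ClassO6 Wd 3 → Surj Wd 3 →
      Even (padicValInt 3 Wd.minimalDiscriminantInt) →
      Wd.minimalDiscriminantInt / 3 ^ padicValInt 3 Wd.minimalDiscriminantInt % 3 = 1 →
      Wd.analyticRank = 0 → MissingUpperBoundAt Wd 3) :
    Summit.BirchSwinnertonDyer.BirchSwinnertonDyer.Theses.CyclotomicUntwist.PSRankOneLowerHalfAtThree := by
  intro W _ _ _hncm hO6 hsurj hev hsq hr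
  exact lowerHalf_psRows_of_eisenstein_of_waldspurger_of_control_of_psRankZeroUpperHalfOnto hF hE hV hC hU0 W hO6
    hsurj hev hsq hr

end Summit.BirchSwinnertonDyer.BirchSwinnertonDyer.Theorems.CyclotomicUntwistOfSOED

end
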